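import Summits.SmoothPoincare4.SmoothPoincare4.Theses.InformationMetricHadamard
import Summits.SmoothPoincare4.SmoothPoincare4.Theorems.InformationMetricHadamardC0AhRecognitionStubExpDifferentialNormGe
import Summits.SmoothPoincare4.SmoothPoincare4.Theorems.InformationMetricHadamardC0AhRecognitionStubNormSubLeEdist
import Summits.SmoothPoincare4.SmoothPoincare4.Theorems.InformationMetricHadamardHadamardConvexBoundarySphereConvex
import Summits.SmoothPoincare4.SmoothPoincare4.Theorems.InformationMetricHadamardConvexEndRecognitionExp
import Literature.Geometry.Riemannian.ExpMapGaussLemma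
import Literature.Geometry.Riemannian.HopfRinowHeineBorel
import Literature.Geometry.Riemannian.AHCompleteness

/-!
# Line `core-distance-morse`, crux `InformationMetricHadamard.C0AhRecognition` (stmt-SmoothPoincare4-6015) — stub E1, helper 1: the polar package of a Cartan–Hadamard manifold

For the apex stub `stub_gradientLikeField` (Grove–Shiohama gradient-like field) all the
Riemannian geometry that is needed about the complete, simply connected, nonpositively curved
`(W⁵, G)` is packaged ONCE here, in terms of diffeomorphisms only, so that the later helper
files never mention connections, geodesics or curvature:

* `helper_gradientLikeField_1` — there is a family of diffeomorphisms `Ex p : ℝ⁵ ≅ W`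
  (`Ex p = exp_p`, `HadamardConvex.exists_expDiffeomorph`) with
  (i) `Ex p 0 = p`;
  (ii) polar distance `d_G(p, Ex p u) = |u|_{G_p}` (`HadamardConvex.edist_expMap_eq`);
  (iii) `(Ex y)⁻¹` is `1`-Lipschitz from `(W, d_G)` to `(ℝ⁵, |·|_{G_y})` — the CAT(0) comparison,
  from the Rauch stub R (`stub_expDifferentialNormGe`) and the calibration stub L
  (`stub_normSubLeEdist`);
  (iv) the Gauss lemma `G(d(Ex p)_u u, d(Ex p)_u w) = G_p(u, w)` (`gaussLemma`);
  (v) reversal of radial geodesics `(Ex (Ex p u))⁻¹ p = −d(Ex p)_u u`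
  (`HadamardConvexBoundary.expMap_expMap_neg`).

Everything is proved (kind = proof); no definitions.
-/

noncomputable section

-- the prescribed namespace `Summit.<P>.<Sub>.…` duplicates `SmoothPoincare4` (P = Sub)
set_option linter.dupNamespace false

open scoped Manifold ContDiff Topology ENNReal NNReal
open Set Function Bundle

namespace Summit.SmoothPoincare4.SmoothPoincare4.Cruxes.C0AhRecognition.CoreDistanceMorse

open Literature.Geometry.Lorentzian (PseudoRiemannianMetric IsGeodesicallyComplete)
open Literature.Geometry.Lorentzian.PseudoRiemannianMetric
open Literature.Geometry.Riemannian Literature.Geometry.Riemannian.SimpleAH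
open Summit.SmoothPoincare4.SmoothPoincare4.Theorems

set_option maxHeartbeats 800000 in
/-- **E1 helper 1 (polar package of a Cartan–Hadamard `5`-manifold).** For `(W, G)` complete
(closed distance balls compact), simply connected, with sectional curvature `≤ 0`, there is a
family of diffeomorphisms `Ex p : ℝ⁵ ≅ W` (the exponential maps, Lee 2018 Thm. 12.8) with
`Ex p 0 = p`, `d_G(p, Ex p u) = |u|_{G_p}`, `|(Ex y)⁻¹ p − (Ex y)⁻¹ q|_{G_y} ≤ d_G(p, q)` (Rauch
comparison integrated: stubs R and L), the Gauss lemma `G(d(Ex p)_u u, d(Ex p)_u w) = G_p(u, w)`,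
and the reversal identity `(Ex (Ex p u))⁻¹ p = −d(Ex p)_u u`.
[cite: Lee2018, Thm. 12.8; BridsonHaefliger1999, Ch. II.1, Prop. 1.4 (1) and II.4] -/
theorem helper_gradientLikeField_1 :
    ∀ (W : Type) [TopologicalSpace W] [T2Space W] [SecondCountableTopology W]
    [ChartedSpace (EuclideanSpace ℝ (Fin 5)) W] [IsManifold (𝓡 5) ∞ W] [SimplyConnectedSpace W]
    (G : Literature.Geometry.Lorentzian.PseudoRiemannianMetric (𝓡 5) ∞ (EuclideanSpace ℝ (Fin 5))
      (TangentSpace (𝓡 5) : W → Type _)) (hG : G.IsRiemannian),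
    (∀ (x : W) (r : NNReal), IsCompact {y : W | G.edist hG x y ≤ r}) →
    (∀ cov, G.IsLeviCivita cov →
      ∀ (x : W) (X Y : TangentSpace (𝓡 5) x), G.sectionalCurvature cov x X Y ≤ 0) →
    ∃ Ex : W → (EuclideanSpace ℝ (Fin 5) ≃ₘ^∞⟮𝓡 5, 𝓡 5⟯ W),
      (∀ p : W, Ex p 0 = p) ∧
      (∀ (p : W) (u : EuclideanSpace ℝ (Fin 5)),
        G.edist hG p (Ex p u) = ENNReal.ofReal (Real.sqrt (G.val p u u))) ∧
      (∀ (y p q : W), ENNReal.ofReal (Real.sqrt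
          (G.val y ((Ex y).symm p - (Ex y).symm q) ((Ex y).symm p - (Ex y).symm q))) ≤
        G.edist hG p q) ∧
      (∀ (p : W) (u w : EuclideanSpace ℝ (Fin 5)),
        G.val (Ex p u) (mfderiv (𝓡 5) (𝓡 5) (Ex p) u u) (mfderiv (𝓡 5) (𝓡 5) (Ex p) u w) =
          G.val p u w) ∧
      (∀ (p : W) (u : EuclideanSpace ℝ (Fin 5)),
        (Ex (Ex p u)).symm p = -(mfderiv (𝓡 5) (𝓡 5) (Ex p) u u)) := by
  intro W _ _ _ _ _ _ G hG hcpt hsec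
  -- the Levi-Civita connection of `G` and its regularity
  haveI hLC : G.HasLeviCivita := G.hasLeviCivita
  have hk1 : ((1 : ℕ∞) : ℕ∞ω) + 1 ≤ (∞ : ℕ∞ω) := by
    rw [show ((1 : ℕ∞) : ℕ∞ω) + 1 = 2 by norm_num]
    exact WithTop.coe_le_coe.2 le_top
  have hktop : ((⊤ : ℕ∞) : ℕ∞ω) + 1 ≤ (∞ : ℕ∞ω) := le_of_eq rfl
  have h2 : (2 : ℕ∞ω) ≤ (∞ : ℕ∞ω) := WithTop.coe_le_coe.2 le_top
  haveI : CovariantDerivative.ContMDiffCovariantDerivative G.leviCivita 1 :=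
    ⟨G.isLocallyContMDiff_leviCivita_holds 1 hk1 univ isOpen_univ⟩
  haveI : CovariantDerivative.ContMDiffCovariantDerivative G.leviCivita ∞ :=
    ⟨G.isLocallyContMDiff_leviCivita_holds ⊤ hktop univ isOpen_univ⟩
  have hcov₁ : G.leviCivita.IsLocallyContMDiff 1 := G.isLocallyContMDiff_leviCivita_holds 1 hk1
  -- nonpositive sectional curvature ⇒ `Rm(X, Y, Y, X) ≤ 0` on all pairs
  have hLCiv : G.IsLeviCivita G.leviCivita := isLeviCivita_leviCivita_holds (g := G)
  have hsec' : ∀ (x : W) (X Y : TangentSpace (𝓡 5) x),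
      G.curvatureForm G.leviCivita x X Y Y X ≤ 0 :=
    curvatureForm_leviCivita_nonpos_of_orthonormal h2 hG fun x X Y hX hY hXY ↦ by
      rw [← sectionalCurvature_of_orthonormal G G.leviCivita x hX hY hXY]
      exact hsec _ hLCiv x X Y
  -- Heine–Borel ⇒ geodesically complete (Hopf–Rinow)
  haveI : LocallyPathConnectedSpace W :=
    ChartedSpace.locallyPathConnectedSpace (EuclideanSpace ℝ (Fin 5)) W
  have hc : IsGeodesicallyComplete G.leviCivita :=
    (isGeodesicallyComplete_iff_isCompact_setOf_edist_le G le_rfl hG).2 hcpt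
  -- the exponential maps as diffeomorphisms
  have hex := fun p : W ↦ HadamardConvex.exists_expDiffeomorph (g := G) hG hc hsec' p
  choose Ex hEx using hex
  have hExF : ∀ (p : W) (u : EuclideanSpace ℝ (Fin 5)),
      Ex p u = expMap G.leviCivita p (show TangentSpace (𝓡 5) p from u) :=
    fun p u ↦ congr_fun (hEx p) u
  have hmf : ∀ (p : W) (u : EuclideanSpace ℝ (Fin 5)),
      mfderiv (𝓡 5) (𝓡 5) (Ex p) u = mfderiv (𝓡 5) (𝓡 5)
        (fun u : EuclideanSpace ℝ (Fin 5) ↦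
          expMap G.leviCivita p (show TangentSpace (𝓡 5) p from u)) u := by
    intro p u
    have h : ((Ex p : EuclideanSpace ℝ (Fin 5) → W)) = fun u : EuclideanSpace ℝ (Fin 5) ↦
        expMap G.leviCivita p (show TangentSpace (𝓡 5) p from u) := hEx p
    rw [h]
  refine ⟨Ex, ?_, ?_, ?_, ?_, ?_⟩
  · -- (i) `Ex p 0 = p`
    intro p
    rw [hExF]
    exact expMap_zero (cov := G.leviCivita) p
  · -- (ii) polar distance
    intro p u
    rw [hExF]
    exact HadamardConvex.edist_expMap_eq hG hc hsec' p u
  · -- (iii) `(Ex y)⁻¹` is `1`-Lipschitz: stub R (Rauch) fed into stub L (calibration)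
    intro y p q
    refine stub_normSubLeEdist W G hG y (Ex y) (fun u w ↦ ?_) p q
    rw [hmf, hExF]
    exact stub_expDifferentialNormGe W G hG hcov₁ hc hsec' y u w
  · -- (iv) Gauss lemma
    intro p u w
    have hu : (show TangentSpace (𝓡 5) p from u) ∈ expDomain G.leviCivita p := by
      rw [expDomain_eq_univ hc]
      exact mem_univ _
    have h := gaussLemma (g := G) le_rfl p hu (show TangentSpace (𝓡 5) p from w)
    rw [hmf, hExF]
    exact (G.symm _ _ _).trans (h.trans (G.symm _ _ _))
  · -- (v) reversal of the radial geodesic from `p` through `Ex p u`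
    intro p u
    have h := HadamardConvexBoundary.expMap_expMap_neg (g := G) hc p
      (show TangentSpace (𝓡 5) p from u)
    -- `Ex q (-V) = p` with `q = Ex p u`, `V = d(Ex p)_u u`
    have h' : Ex (Ex p u) (-(mfderiv (𝓡 5) (𝓡 5) (Ex p) u u)) = p := by
      rw [hExF (Ex p u), hmf, hExF p]
      exact h
    have h'' := congrArg (Ex (Ex p u)).symm h'
    rw [Diffeomorph.symm_apply_apply] at h''
    exact h''.symm

end Summit.SmoothPoincare4.SmoothPoincare4.Cruxes.C0AhRecognition.CoreDistanceMorse

end
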